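import Mathlib.Algebra.MvPolynomial.Expand
import Mathlib.Data.Nat.Log
import Literature.RingTheory.FormalGroups.DegreeCongruence
import HarnessLib

/-!
# Hazewinkel's `p`-typical logarithm `f_V(X) = Σ_n a_n(V) X^{pⁿ}` over `ℚ[V₁, V₂, …]`
# ([Hazewinkel 1978] §2.2, §3.3 (3.3.8)–(3.3.9), §15.2)

Topic `Literature/RingTheory/FormalGroups`; namespace `Literature.RingTheory.FormalGroups`.  Two DEFINITIONS
(`typLogCoeff p n = a_n(V)`, `typLog p = f_V`) + fully proved theorems; no named fact, no instance, no `sorry`.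
Setting: a prime `p`; `K = MvPolynomial ℕ ℚ = ℚ[V]` with `V_{i+1} := X i` (the `i`-th variable enters the logarithm at
the exponent `p^{i+1}`); `σ_q = MvPolynomial.expand q` (`X i ↦ (X i)^q`), so `σ_{p^j}` is Hazewinkel's `σ^j`.  The
coefficients `a_n ∈ K` of the universal `p`-typical logarithm are defined by the FUNCTIONAL-EQUATION recursion

  `a_0 = 1`,  `p · a_{n+1} = Σ_{i=0}^{n} X_i · σ^{i+1}(a_{n-i})`     ([Hazewinkel1978] (3.3.9) with `V_{i+1} = X_i`),

i.e. `f_V(X) = X + Σ_{i≥1} (V_i/p) (σ^i_* f_V)(X^{p^i})`, and `f_V = Σ_n a_n X^{pⁿ}`.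

* `typLogCoeff_zero`, `typLogCoeff_succ` (the recursion), `pow_smul_typLogCoeff_mem_range` (`pⁿ a_n ∈ ℤ[V]`);
* `typProj p m` — the `ℚ`-algebra endomorphism of `ℚ[V]` killing the `X k` with `p^{k+1} > m`; `typProj_typLogCoeff` (`a_n`
  involves only `X_0, …, X_{n-1}`: it is fixed as soon as `pⁿ ≤ m`), `typLogCoeff_succ_sub_typProj` (the `X_k`-linear
  term of `a_{k+1}` is `X_k / p`);
* `typLog p = f_V`: `coeff_typLog_pow`, `coeff_typLog_of_ne_pow`, `constantCoeff_typLog`, `coeff_one_typLog`;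
* `coeff_psubst_eq_sum_of_pow_support` — for a series `g` supported on the exponents `pⁿ` and `Q` without constant term,
  `[X^d] g(Q) = Σ_{n ≤ |d|} [X^{pⁿ}]g · [X^d] Q^{pⁿ}` (a finite sum).

## References
* [Hazewinkel1978] M. Hazewinkel, *Formal Groups and Applications* (1978), §2.2 (functional-equation lemma, the series
  `f_g`), §3.3 (3.3.8)–(3.3.9) (the recursion for `a_n(V)`), §15.2 (the universal `p`-typical law `F_V`).
-/

noncomputable section

namespace Literature.RingTheory.FormalGroups

open MvPolynomial Finset

variable (p : ℕ) [hp : Fact p.Prime]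

/-! ## §1 The coefficients `a_n(V)` -/

omit hp in
/-- Hazewinkel's `a_n(V) ∈ ℚ[V]`: `a_0 = 1`, `a_{n+1} = p⁻¹ Σ_{i=0}^{n} X_i · σ^{i+1}(a_{n-i})` with `σ^j = expand (p^j)`.
[cite: Hazewinkel1978, §3.3 (3.3.9)] -/
def typLogCoeff : ℕ → MvPolynomial ℕ ℚ
  | 0 => 1
  | n + 1 => (p : ℚ)⁻¹ • ∑ i ∈ Finset.range (n + 1), X i * MvPolynomial.expand (p ^ (i + 1)) (typLogCoeff (n - i))
  decreasing_by omega

omit hp in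
/-- `a_0 = 1`. [cite: Hazewinkel1978, §3.3 (3.3.9)] -/
@[simp] theorem typLogCoeff_zero : typLogCoeff p 0 = 1 := by
  rw [typLogCoeff]

omit hp in
/-- The recursion `a_{n+1} = p⁻¹ Σ_{i=0}^{n} X_i σ^{i+1}(a_{n-i})`. [cite: Hazewinkel1978, §3.3 (3.3.9)] -/
theorem typLogCoeff_succ (n : ℕ) : typLogCoeff p (n + 1) =
    (p : ℚ)⁻¹ • ∑ i ∈ Finset.range (n + 1), X i * MvPolynomial.expand (p ^ (i + 1)) (typLogCoeff p (n - i)) := by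
  rw [typLogCoeff]

/-- The recursion, cleared of the denominator: `p · a_{n+1} = Σ_{i=0}^{n} X_i σ^{i+1}(a_{n-i})`. [cite: Hazewinkel1978, §3.3 (3.3.9)] -/
theorem smul_typLogCoeff_succ (n : ℕ) : (p : ℚ) • typLogCoeff p (n + 1) =
    ∑ i ∈ Finset.range (n + 1), X i * MvPolynomial.expand (p ^ (i + 1)) (typLogCoeff p (n - i)) := by
  rw [typLogCoeff_succ, smul_smul, mul_inv_cancel₀ (by exact_mod_cast hp.out.ne_zero), one_smul]

/-- The inclusion `ℤ[V] ↪ ℚ[V]` commutes with `σ_q = expand q`. [folklore] -/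
private theorem expand_mem_range {q : ℕ} {x : MvPolynomial ℕ ℚ}
    (hx : x ∈ (MvPolynomial.map (Int.castRingHom ℚ) : MvPolynomial ℕ ℤ →+* MvPolynomial ℕ ℚ).range) :
    MvPolynomial.expand q x ∈ (MvPolynomial.map (Int.castRingHom ℚ) : MvPolynomial ℕ ℤ →+* MvPolynomial ℕ ℚ).range := by
  obtain ⟨y, rfl⟩ := hx
  exact ⟨MvPolynomial.expand q y, by simp only [MvPolynomial.map_expand]⟩

/-- **`pⁿ · a_n(V)` has integer coefficients.** [cite: Hazewinkel1978, §2.3 (2.3.5)] -/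
theorem pow_smul_typLogCoeff_mem_range (n : ℕ) :
    (p : ℚ) ^ n • typLogCoeff p n ∈ (MvPolynomial.map (Int.castRingHom ℚ) : MvPolynomial ℕ ℤ →+* MvPolynomial ℕ ℚ).range := by
  induction n using Nat.strong_induction_on with
  | _ n ih =>
    cases n with
    | zero => exact ⟨1, by simp⟩
    | succ n =>
      rw [pow_succ, mul_smul, smul_typLogCoeff_succ, Finset.smul_sum]
      refine Subring.sum_mem _ fun i hi => ?_
      rw [Finset.mem_range] at hi
      have hsplit : (p : ℚ) ^ n = (p : ℚ) ^ i * (p : ℚ) ^ (n - i) := by rw [← pow_add]; congr 1; omega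
      have key : (p : ℚ) ^ n • (X i * MvPolynomial.expand (p ^ (i + 1)) (typLogCoeff p (n - i))) =
          algebraMap ℚ _ ((p : ℚ) ^ i) *
            (X i * MvPolynomial.expand (p ^ (i + 1)) ((p : ℚ) ^ (n - i) • typLogCoeff p (n - i))) := by
        rw [map_smul (MvPolynomial.expand (p ^ (i + 1))), hsplit, Algebra.smul_def, Algebra.smul_def, map_mul]
        ring
      rw [key]
      refine Subring.mul_mem _ ⟨MvPolynomial.C ((p : ℤ) ^ i), by simp⟩
        (Subring.mul_mem _ ⟨X i, by simp⟩ (expand_mem_range (ih (n - i) (by omega))))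

/-! ## §2 The projections `π_m` (kill the variables not yet seen in degree `≤ m`) -/

omit hp in
/-- `π_m : ℚ[V] → ℚ[V]`, `X k ↦ X k` if `p^{k+1} ≤ m`, `X k ↦ 0` otherwise. [cite: Hazewinkel1978, §15.2] -/
def typProj (m : ℕ) : MvPolynomial ℕ ℚ →ₐ[ℚ] MvPolynomial ℕ ℚ :=
  MvPolynomial.aeval fun k => if p ^ (k + 1) ≤ m then X k else 0

omit hp in
/-- `π_m(X k) = X k` when `p^{k+1} ≤ m`. [cite: Hazewinkel1978, §15.2] -/
theorem typProj_X_of_le {m k : ℕ} (h : p ^ (k + 1) ≤ m) : typProj p m (X k) = X k := by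
  simp [typProj, h]

omit hp in
/-- `π_m(X k) = 0` when `m < p^{k+1}`. [cite: Hazewinkel1978, §15.2] -/
theorem typProj_X_of_lt {m k : ℕ} (h : m < p ^ (k + 1)) : typProj p m (X k) = 0 := by
  simp [typProj, not_le.mpr h]

omit hp in
/-- `π_m` commutes with `σ_q` (`q ≥ 1`). [cite: Hazewinkel1978, §15.2] -/
theorem typProj_expand {m q : ℕ} (hq : 1 ≤ q) (x : MvPolynomial ℕ ℚ) :
    typProj p m (MvPolynomial.expand q x) = MvPolynomial.expand q (typProj p m x) := by
  have h : (typProj p m).comp (MvPolynomial.expand q) = (MvPolynomial.expand q).comp (typProj p m) := by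
    refine MvPolynomial.algHom_ext fun k => ?_
    simp only [AlgHom.comp_apply, MvPolynomial.expand_X, map_pow]
    by_cases hk : p ^ (k + 1) ≤ m
    · rw [typProj_X_of_le p hk, MvPolynomial.expand_X]
    · rw [typProj_X_of_lt p (not_le.mp hk), map_zero, zero_pow (by omega)]
  exact congrArg (fun φ => φ x) h

/-- **`a_n` involves only `X_0, …, X_{n-1}`**: `π_m(a_n) = a_n` whenever `pⁿ ≤ m`. [cite: Hazewinkel1978, §15.2 (15.2.2)] -/
theorem typProj_typLogCoeff {m : ℕ} : ∀ n, p ^ n ≤ m → typProj p m (typLogCoeff p n) = typLogCoeff p n := by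
  intro n
  induction n using Nat.strong_induction_on with
  | _ n ih =>
    cases n with
    | zero => intro _; simp
    | succ n =>
      intro hn
      rw [typLogCoeff_succ, map_smul, map_sum]
      congr 1
      refine Finset.sum_congr rfl fun i hi => ?_
      rw [Finset.mem_range] at hi
      have hpow : p ^ (i + 1) ≤ m := le_trans (Nat.pow_le_pow_right hp.out.pos (by omega)) hn
      rw [map_mul, typProj_X_of_le p hpow, typProj_expand p (Nat.one_le_pow _ _ hp.out.pos),
        ih (n - i) (by omega) (le_trans (Nat.pow_le_pow_right hp.out.pos (by omega)) hn)]

/-- **The `X_k`-linear term of `a_{k+1}` is `X_k/p`**: with `π = π_{p^{k+1}-1}` (which kills exactly `X_k, X_{k+1}, …`),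
`a_{k+1} - π(a_{k+1}) = p⁻¹ X_k`. [cite: Hazewinkel1978, §15.2 (15.2.2)] -/
theorem typLogCoeff_succ_sub_typProj (k : ℕ) :
    typLogCoeff p (k + 1) - typProj p (p ^ (k + 1) - 1) (typLogCoeff p (k + 1)) = (p : ℚ)⁻¹ • X k := by
  have hp1 : 1 < p := hp.out.one_lt
  rw [typLogCoeff_succ, map_smul, ← smul_sub, map_sum, ← Finset.sum_sub_distrib, Finset.sum_range_succ,
    Finset.sum_eq_zero, zero_add, Nat.sub_self, typLogCoeff_zero, map_one, mul_one,
    typProj_X_of_lt p (Nat.sub_lt (pow_pos hp.out.pos _) one_pos), sub_zero]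
  intro i hi
  rw [Finset.mem_range] at hi
  have hik : p ^ (i + 1) ≤ p ^ (k + 1) - 1 := by
    have : p ^ (i + 1) < p ^ (k + 1) := Nat.pow_lt_pow_right hp1 (by omega)
    omega
  rw [map_mul, typProj_X_of_le p hik, typProj_expand p (Nat.one_le_pow _ _ hp.out.pos),
    typProj_typLogCoeff p (k - i) ?_, sub_self]
  have : p ^ (k - i) < p ^ (k + 1) := Nat.pow_lt_pow_right hp1 (by omega)
  omega

/-! ## §3 The logarithm `f_V = Σ a_n X^{pⁿ}` -/

/-- Hazewinkel's universal `p`-typical logarithm `f_V(X) = Σ_{n ≥ 0} a_n(V) X^{pⁿ} ∈ ℚ[V]⟦X⟧`. [cite: Hazewinkel1978, §15.2 (15.2.2)] -/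
def typLog : PowerSeries (MvPolynomial ℕ ℚ) :=
  PowerSeries.mk fun m => if m = p ^ Nat.log p m then typLogCoeff p (Nat.log p m) else 0

/-- `[X^{pⁿ}] f_V = a_n`. [cite: Hazewinkel1978, §15.2 (15.2.2)] -/
@[simp] theorem coeff_typLog_pow (n : ℕ) : PowerSeries.coeff (p ^ n) (typLog p) = typLogCoeff p n := by
  rw [typLog, PowerSeries.coeff_mk, Nat.log_pow hp.out.one_lt, if_pos rfl]

omit hp in
/-- `[X^m] f_V = 0` if `m` is not a power of `p`. [cite: Hazewinkel1978, §15.2 (15.2.2)] -/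
theorem coeff_typLog_of_ne_pow {m : ℕ} (h : ∀ n, m ≠ p ^ n) : PowerSeries.coeff m (typLog p) = 0 := by
  rw [typLog, PowerSeries.coeff_mk, if_neg (h _)]

/-- `f_V(0) = 0`. [cite: Hazewinkel1978, §15.2 (15.2.2)] -/
@[simp] theorem constantCoeff_typLog : PowerSeries.constantCoeff (typLog p) = 0 := by
  rw [← PowerSeries.coeff_zero_eq_constantCoeff_apply]
  exact coeff_typLog_of_ne_pow p fun n => (pow_pos hp.out.pos n).ne

/-- `[X¹] f_V = 1`. [cite: Hazewinkel1978, §15.2 (15.2.2)] -/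
@[simp] theorem coeff_one_typLog : PowerSeries.coeff 1 (typLog p) = 1 := by
  have h := coeff_typLog_pow p 0
  rwa [pow_zero, typLogCoeff_zero] at h

/-- `f_V ≡ π_m f_V (mod deg m+1)`: the coefficients of `f_V` in degree `≤ m` are fixed by `π_m`. [cite: Hazewinkel1978, §15.2] -/
theorem coeff_map_typProj_typLog {m i : ℕ} (hi : i ≤ m) :
    PowerSeries.coeff i (PowerSeries.map (typProj p m).toRingHom (typLog p)) = PowerSeries.coeff i (typLog p) := by
  rw [PowerSeries.coeff_map]
  by_cases h : ∃ n, i = p ^ n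
  · obtain ⟨n, rfl⟩ := h
    rw [coeff_typLog_pow]
    exact typProj_typLogCoeff p n hi
  · push Not at h
    rw [coeff_typLog_of_ne_pow p h, map_zero]

/-- The degree-`≤ p^{k+1}` coefficients of `f_V` versus `π_{p^{k+1}-1} f_V`: they agree except at `X^{p^{k+1}}`, where they
differ by `X_k/p`. [cite: Hazewinkel1978, §15.2 (15.2.2)] -/
theorem coeff_typLog_sub_map_typProj {k i : ℕ} (hi : i ≤ p ^ (k + 1)) :
    PowerSeries.coeff i (typLog p) - PowerSeries.coeff i (PowerSeries.map (typProj p (p ^ (k + 1) - 1)).toRingHom (typLog p)) =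
      if i = p ^ (k + 1) then (p : ℚ)⁻¹ • X k else 0 := by
  rcases Nat.eq_or_lt_of_le hi with rfl | hlt
  · rw [if_pos rfl, PowerSeries.coeff_map, coeff_typLog_pow]
    exact typLogCoeff_succ_sub_typProj p k
  · rw [if_neg hlt.ne, coeff_map_typProj_typLog p (by omega), sub_self]

/-! ## §4 Substituting into a series supported on `p`-power exponents -/

omit hp in
/-- **Coefficients of `g(Q)` for `g` supported on the exponents `pⁿ`**: if `[X^m]g = 0` unless `m` is a power of `p` and
`Q(0) = 0`, then `[X^d] g(Q) = Σ_{n ≤ |d|} [X^{pⁿ}]g · [X^d](Q^{pⁿ})`. [cite: Hazewinkel1978, §2.4] -/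
theorem coeff_psubst_eq_sum_of_pow_support (hp' : p.Prime) {R : Type*} [CommRing R] {τ : Type*} {g : PowerSeries R}
    (hg : ∀ m, (∀ n, m ≠ p ^ n) → PowerSeries.coeff m g = 0) {Q : MvPowerSeries τ R}
    (hQ : MvPowerSeries.constantCoeff Q = 0) (d : τ →₀ ℕ) :
    MvPowerSeries.coeff d (PowerSeries.subst Q g) =
      ∑ n ∈ Finset.range (d.degree + 1), PowerSeries.coeff (p ^ n) g * MvPowerSeries.coeff d (Q ^ p ^ n) := by
  rw [PowerSeries.coeff_subst (PowerSeries.HasSubst.of_constantCoeff_zero hQ)]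
  rw [finsum_eq_sum_of_support_subset _ (s := (Finset.range (d.degree + 1)).image (fun n => p ^ n))]
  · rw [Finset.sum_image fun a _ b _ hab => Nat.pow_right_injective hp'.two_le hab]
    simp only [smul_eq_mul]
  · intro m hm
    rw [Function.mem_support] at hm
    rw [Finset.coe_image, Finset.coe_range]
    by_cases h : ∃ n, m = p ^ n
    · obtain ⟨n, rfl⟩ := h
      refine ⟨n, ?_, rfl⟩
      rw [Set.mem_Iio]
      by_contra hn
      rw [not_lt] at hn
      apply hm
      have hdeg : d.degree < p ^ n := lt_of_lt_of_le (by omega) (le_of_lt (Nat.lt_pow_self hp'.one_lt))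
      rw [MvPowerSeries.coeff_of_lt_order, smul_zero]
      exact lt_of_lt_of_le (by exact_mod_cast hdeg) (natCast_le_order_pow hQ _)
    · push Not at h
      exact absurd (by rw [hg m h, zero_smul]) hm

end Literature.RingTheory.FormalGroups
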